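import Literature.Analysis.FluidPDE.LocalTypeISlabProfile
import Summits.NavierStokesRegularity.NavierStokesRegularity.Theorems.AdaptedFrequencyFrequencyRigidityClassicalSuitableSlab
import HarnessLib

/-!
# Crux `FrequencyRigidity` (stmt-NavierStokesRegularity-2955), line `scaled-energy-split`:
# a finite-scaled-energy witness has a local Type I singular point at the origin

Helper file (`--supports stmt-NavierStokesRegularity-2955`; theorems only, sorry-free).  Stub
`stub_localTypeISingularity_of_finiteWitness` anchors Stub 2 (`stub_finiteScaledEnergyLiouville`,
the flat Liouville theorem in the Albritton–Barker class `𝐈 = 𝐈(ℝ³ × ℝ₋) < ∞`) in the printed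
vocabulary of Albritton–Barker 2019: a classical solution `(u, p)` of Navier–Stokes (`ν = 1`,
`f = 0`) on the backward time set `(−∞, 0)` with
`𝐈 = sup_{Q(z,r) ⊆ ℝ³ × ℝ₋} (A + C + D + E)(Q(z, r)) < ∞` (computed with `G = ∇u`) and a
backward-singular origin has, after normalising the pressure to mean zero on `B(0, 1)` at every
time, a **local Type I singular point** at the space–time origin in the sense of A–B §1 / Def. 2.1
(`IsLocalTypeISingularPoint 1 0 u p'`).  Hence a counterexample to Stub 2 would inhabit the
registered OPEN statement `LocalTypeISingularityExists` (first bullet of A–B Thm 1.1).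

Proof.  The class bookkeeping `classical ⇒ suitable weak on the slab with G = ∇u` is the landed
`stub_classicalSuitableSlab` (CKN 1982, §2); the packaging `slab profile with 𝐈 < ∞ and singular
origin ⇒ IsLocalTypeISingularPoint 1 0 u (p − [p]_{B(0,1)})` is the tree's
`isLocalTypeISingularPoint_of_slabProfile` (`LocalTypeISlabProfile.lean`: restriction to the unit
parabolic ball, `sub_pressure` by the `L^{3/2}_loc` unit-ball means, `A + E ≤ 𝐈` for the global
classes, `‖p − [p]‖_{L^{3/2}(Q(0,1))} ≲ D ≤ 𝐈`, and `D(Q(z,r); p − [p]_{B(0,1)}) = D(Q(z,r); p)`).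

## References

* D. Albritton, T. Barker, *On local Type I singularities of the Navier–Stokes equations and
  Liouville theorems*, J. Math. Fluid Mech. 21 (2019), no. 43 = arXiv:1811.00502, §1 (Thm 1.1 and
  the displays defining `A, C, D, E, 𝐈`; singular and Type I points), Def. 2.1.
  [AlbrittonBarker2019]
* L. Caffarelli, R. Kohn, L. Nirenberg, *Partial regularity of suitable weak solutions of the
  Navier–Stokes equations*, Comm. Pure Appl. Math. 35 (1982), §2. [CaffarelliKohnNirenberg1982]
-/

noncomputable section

set_option linter.dupNamespace false

namespace Summit.NavierStokesRegularity.NavierStokesRegularity.Theorems.FrequencyRigidity.ScaledEnergySplit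

open Literature.Analysis.FluidPDE MeasureTheory Set Function Metric

/-- **A finite-scaled-energy witness has a local Type I singular point at the origin** (stub
`stub_localTypeISingularity_of_finiteWitness` of line `scaled-energy-split`).  If `(u, p)` is a
classical solution of Navier–Stokes (`ν = 1`, `f = 0`) on the time set `(−∞, 0)` with
Albritton–Barker quantity `𝐈(ℝ³ × ℝ₋) < ∞` (computed with the classical gradient `G = ∇u`) and
the origin is a backward singular point of `u`, then for the normalised pressure
`p' = p − [p]_{B(0,1)}(t)` the origin is a local Type I singular point in the unit parabolic ball,
`IsLocalTypeISingularPoint 1 0 u p'` (Albritton–Barker 2019, §1 with Def. 2.1): `(u, p)` is a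
suitable weak solution on the slab with weak gradient `∇u` (`stub_classicalSuitableSlab`, CKN
1982 §2), and slab profiles with `𝐈 < ∞` and a singular origin are local Type I singular points
(`isLocalTypeISingularPoint_of_slabProfile`).
[cite: AlbrittonBarker2019, §1 (definition of Type I singularity) and Def. 2.1] -/
theorem stub_localTypeISingularity_of_finiteWitness : ∀ (u : ℝ → EuclideanSpace ℝ (Fin 3) → EuclideanSpace ℝ (Fin 3)) (p : ℝ → EuclideanSpace ℝ (Fin 3) → ℝ), Literature.Analysis.FluidPDE.IsClassicalNSSolutionOn (Set.Iio 0) 1 0 u p → Literature.Analysis.FluidPDE.typeIBound (Set.Iio (0:ℝ) ×ˢ Set.univ) u p (fun t x => fderiv ℝ (u t) x) < ⊤ → Literature.Analysis.FluidPDE.IsBackwardSingularPoint u 0 → ∃ p' : ℝ → EuclideanSpace ℝ (Fin 3) → ℝ, Literature.Analysis.FluidPDE.IsLocalTypeISingularPoint 1 0 u p' := by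
  intro u p h hI hsing
  obtain ⟨hsw, hwg⟩ := stub_classicalSuitableSlab u p h
  exact ⟨fun t x => p t x - ⨍ y in ball (0 : EuclideanSpace ℝ (Fin 3)) 1, p t y,
    isLocalTypeISingularPoint_of_slabProfile hsw hwg hI hsing⟩

end Summit.NavierStokesRegularity.NavierStokesRegularity.Theorems.FrequencyRigidity.ScaledEnergySplit
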